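import Summits.AtomisticToContinuum.HydrodynamicLimit.Theorems.OneFlightGossipEngineEnergyCurrentTailsSplitThermal
import Summits.AtomisticToContinuum.HydrodynamicLimit.Theses.WarmColdDichotomy
import HarnessLib

/-!
# Crux `EnergyCurrentTails` (stmt-AtomisticToContinuum-9235), line `quartic-schur-ledger`:
# the QMF₄ composition read on the item's PRIMARY copy `WarmColdDichotomy.EnergyCurrentTails`

`WarmColdDichotomy.EnergyCurrentTails` and `OneFlightGossipEngine.EnergyCurrentTails` are textually identical
route declarations (definitionally equal `Prop`s); this file restates the landed composition
`EnergyCurrentTails_of_mixingFloor4 : QMF₄ → S2a″ → OneFlightGossipEngine.EnergyCurrentTails` with the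
WarmColdDichotomy conclusion, so that a `--glue-by` split of the shared item can be filed on either route.
-/

namespace Summit.AtomisticToContinuum.HydrodynamicLimit.Theorems.QuarticSchurLedger

open Literature.MathematicalPhysics.KineticTheory Literature.Analysis.FluidPDE
open MeasureTheory Set

/-- **QMF₄ → S2a″ → `WarmColdDichotomy.EnergyCurrentTails`** (the item's primary decl; `show` + the landed
`EnergyCurrentTails_of_mixingFloor4`). [folklore] -/
theorem EnergyCurrentTails_warmCold_of_mixingFloor4 :
    (∀ (a₀ θ₀ : T3 → ℝ) (u₀ : T3 → V3), Continuous a₀ → Continuous θ₀ → Continuous u₀ → (∀ x, 0 < a₀ x) →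
    (∀ x, 0 < θ₀ x) → ∃ σ₀ : ℝ, 0 < σ₀ ∧ ∀ σ, 0 < σ → σ < σ₀ → ∀ T, 0 < T → ∀ Φ : (N : ℕ) → HardSphereFlow
    (Torus.geometry (Fin 3)) (hsDiameter σ N) (N+1), ∃ K₀, 0 ≤ K₀ ∧ ∃ c, 0 < c ∧ ∃ N₀, ∀ N, N₀ ≤ N → ∀ s
    t, 0 ≤ s → s ≤ t → t ≤ T → ENNReal.ofReal (c*(σ^2*((N+1 : ℕ) : ℝ)^((1 : ℝ)/3)))*∫⁻ τ in Ioc s t, (∫⁻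
    z, ENNReal.ofReal (((N+1 : ℕ) : ℝ)⁻¹*∑ i, if K₀ < ‖((Φ N).flow τ z i).2‖ then ‖((Φ N).flow τ z i).2‖^4
    else 0) ∂localGibbsLaw σ a₀ u₀ θ₀ N (Φ N)) ≤ ∫⁻ z, (∑ᶠ τ ∈ collisionTimes (Torus.geometry (Fin 3))
    (hsDiameter σ N) ((Φ N).flow · z) ∩ Ioc s t, ∑ i, ∑ j, if i = j then 0 else (contactSet
    (Torus.geometry (Fin 3)) _ (hsDiameter σ N) i j).indicator (fun y => if K₀ < ‖(collidePair
    (Torus.geometry (Fin 3)) i j y i).2‖ then ENNReal.ofReal (((N+1 : ℕ) : ℝ)⁻¹*(2*(‖(y i).2‖^2*‖(y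
    j).2‖^2))) else 0) ((Φ N).flow τ z)) ∂localGibbsLaw σ a₀ u₀ θ₀ N (Φ N)) → (∀ (a₀ θ₀ : T3 → ℝ) (u₀ : T3
    → V3), Continuous a₀ → Continuous θ₀ → Continuous u₀ → (∀ x, 0 < a₀ x) → (∀ x, 0 < θ₀ x) → ∃ σ₀ : ℝ, 0
    < σ₀ ∧ ∀ σ, 0 < σ → σ < σ₀ → ∀ T, 0 < T → ∀ Φ : (N : ℕ) → HardSphereFlow (Torus.geometry (Fin 3))
    (hsDiameter σ N) (N+1), ∃ C, 0 ≤ C ∧ ∃ N₀, ∀ N : ℕ, N₀ ≤ N → ∀ s s', 0 ≤ s → s ≤ s' → s' ≤ T → (∫⁻ z,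
    ENNReal.ofReal (((N : ℝ)+1)⁻¹*(Φ N).collisionSum (Ioc s s') (fun col =>
    ‖col.preVel.1‖^2*‖col.preVel.2‖^2) z) ∂localGibbsLaw σ a₀ u₀ θ₀ N (Φ N)) ≤ ENNReal.ofReal (C*(σ^2*((N
    : ℝ)+1)^(1/3 : ℝ)*(s' - s)))*(⨆ r ∈ Icc s s', (∫⁻ z, ENNReal.ofReal (((N : ℝ)+1)⁻¹*∑ i, ‖((Φ N).flow r
    z i).2‖^2) ∂localGibbsLaw σ a₀ u₀ θ₀ N (Φ N)))*(⨆ r ∈ Icc s s', (∫⁻ z, ENNReal.ofReal (((N : ℝ)+1)⁻¹*∑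
    i, ‖((Φ N).flow r z i).2‖^3) ∂localGibbsLaw σ a₀ u₀ θ₀ N (Φ N)))) →
    Summit.AtomisticToContinuum.HydrodynamicLimit.Theses.WarmColdDichotomy.EnergyCurrentTails := by
  intro hQMF hW
  show Summit.AtomisticToContinuum.HydrodynamicLimit.Theses.OneFlightGossipEngine.EnergyCurrentTails
  exact EnergyCurrentTails_of_mixingFloor4 hQMF hW

end Summit.AtomisticToContinuum.HydrodynamicLimit.Theorems.QuarticSchurLedger
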